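import Summits.CriticalPhenomena.Ising3DConformalLimit.Theorems.AnomalousForcesInteractionEtaPositiveNecessity
import Summits.CriticalPhenomena.Ising3DConformalLimit.Theorems.AnomalousForcesInteractionEtaPositiveSplitGlue
import HarnessLib

/-!
# Line `regularity_sign` of crux `EtaPositive` (stmt-CriticalPhenomena-2600): the regularity stub is paid by the route's own crux `MoebiusLimit`

THEOREM-ONLY helper (`--supports stmt-CriticalPhenomena-2600`, registered sub-goal `etaExists_of_moebiusLimit`; no definition, no named
fact, no `sorry`). On route `AnomalousForcesInteraction`, the first stub `stub_etaExists` of the alternative line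
`Cruxes/EtaPositive/Lines/regularity_sign.lean` (= item stmt-CriticalPhenomena-0635: `∃ η, HasIsingExponentEta 3 η`) follows from the
rank-4 crux `MoebiusLimit` (stmt-CriticalPhenomena-1344) that the route's `closes` already consumes: `MoebiusLimit` gives a non-degenerate
pointwise scaling limit (`limitExists_of_moebiusLimit`), and any such limit has a logarithmic exponent `η ∈ [0, 1/2]`
(`HasPointwiseScalingLimit.exists_isingEta`). So, for this route, the η-debt left by the line is exactly its second stub `stub_etaGainIO`
(a power gain over the infrared bound at arbitrarily far sites ⟺ `¬ HasIsingExponentEta 3 0`, `SplitGlue.etaGainIO_iff_not_hasIsingExponentEta_zero`).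
Kernel-checked: `etaExists_of_moebiusLimit`, `etaExists_of_limitExists` (same from item stmt-CriticalPhenomena-4738), and the resulting
one-hypothesis reduction `etaPositive_of_moebiusLimit_of_etaGainIO : MoebiusLimit → EtaGainIO-statement → EtaPositive`.

References: H. Duminil-Copin, ICM 2022 §8.4 [DuminilCopinICM2022]; H. Duminil-Copin, R. Panis, CMP 406 (2025) Thm 1.5 [DuminilCopinPanis2025LowerBounds].
-/

noncomputable section

namespace Summit.CriticalPhenomena.Ising3DConformalLimit.AnomalousForcesInteractionEtaPositive

open Literature.Probability.LatticeModels
open Summit.CriticalPhenomena.Ising3DConformalLimit.Theses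

/-- **Item 4738 ⟹ item 0635**: a non-degenerate pointwise scaling limit of `criticalCorr 3` forces the existence of the logarithmic
exponent `η(3)` (`HasPointwiseScalingLimit.exists_isingEta`). [folklore] -/
theorem etaExists_of_limitExists (h : WeylWindow.LimitExists) : ∃ η : ℝ, Literature.Probability.LatticeModels.HasIsingExponentEta 3 η := by
  obtain ⟨ρ, S, hρ, hlim, hnd⟩ := h
  obtain ⟨η, -, hη⟩ := hlim.exists_isingEta hρ hnd
  exact ⟨η, hη⟩

/-- **Crux r4 `MoebiusLimit` ⟹ stub `stub_etaExists`** (item 1344 ⟹ item 0635), via `limitExists_of_moebiusLimit`. [folklore] -/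
theorem etaExists_of_moebiusLimit : Summit.CriticalPhenomena.Ising3DConformalLimit.Theses.AnomalousForcesInteraction.MoebiusLimit → ∃ η : ℝ, Literature.Probability.LatticeModels.HasIsingExponentEta 3 η :=
  fun h => etaExists_of_limitExists (limitExists_of_moebiusLimit h)

/-- **One-hypothesis reduction of the crux on this route**: given the route's crux `MoebiusLimit`, `EtaPositive` follows from the i.o. gain
`stub_etaGainIO` alone (landed glue `SplitGlue.etaPositive_of_etaExists_of_etaGainIO`, p169603). [folklore] -/
theorem etaPositive_of_moebiusLimit_of_etaGainIO
    (hM : Summit.CriticalPhenomena.Ising3DConformalLimit.Theses.AnomalousForcesInteraction.MoebiusLimit)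
    (hG : ∃ κ C : ℝ, 0 < κ ∧ ∀ N : ℕ, ∃ x : Literature.Probability.LatticeModels.Site 3, (N : ℝ) < ‖x‖ ∧ Literature.Probability.LatticeModels.criticalTwoPoint 3 x ≤ C * (‖x‖ : ℝ) ^ (-(1 + κ))) :
    AnomalousForcesInteraction.EtaPositive :=
  Summit.CriticalPhenomena.Ising3DConformalLimit.Cruxes.EtaPositive.SplitGlue.etaPositive_of_etaExists_of_etaGainIO
    (etaExists_of_moebiusLimit hM) hG

end Summit.CriticalPhenomena.Ising3DConformalLimit.AnomalousForcesInteractionEtaPositive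

end
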